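import Summits.SmoothPoincare4.SmoothPoincare4.Theorems.SymplecticOrigamiOrigamiFoldExistenceStubCleanOnePleatIroningPatch

/-!
# Stub `stub_cleanOnePleatIroning` of line `shadow-pleats` for crux `OrigamiFoldExistence` — III:
# the deletion lemma and the reduction to an IRONING CHART (item stmt-SmoothPoincare4-7844, route SymplecticOrigami; seat c3, S5a worker)

Third helper file for the registered stub `stub_cleanOnePleatIroning` (S5a: a homotopy `4`-sphere
with a CLEAN `1`-pleat round-rim shadow position has a pleat-free one).  Over file II
(`patch ι e R F`, `isSmoothEmbedding_patch`, `round_patch`, the shadow differentials of a patch):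

* `hasPleatedPosition_zero_of_patch` — **the deletion lemma of Disproof.lean §7c (γ) in kernel
  form**: a `1`-pleat position `(ι, δ, e)` of a compact `M` whose chart ball `e 0 (B̄_R)`,
  `R ≥ 2` (both fold spheres inside), is re-embedded by a smooth `F : ℝ⁴ → ℝ⁵` agreeing with
  `ι ∘ e 0` on a shell `R ≤ |u| ≤ R + η`, injective with IMMERSIVE SHADOW `proj5 ∘ F` on `B̄_R`,
  staying above the plane, and SEPARATED from `ι(M ∖ e 0 (B̄_R))`, becomes a `0`-pleat position
  of the same `M` (`HasPleatedPosition M 0`: no chart, shadow immersive above the plane);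
* `ironF Λ ι e₀ u = (Λ u, h(ι (e₀ u)))` — the GRAPHICAL re-embedding over an ironing chart:
  new shadow `Λ`, old heights; its calculus (`proj5_ironF`, `ironF_apply_four`, smoothness,
  injectivity and immersivity from `Λ`);
* `CleanPleatIroningChart` — the ONE remaining ingredient of S5a, as a `Prop` over the line
  vocabulary: every clean `1`-pleat position of a homotopy `4`-sphere admits an IRONING CHART,
  i.e. `R ≥ 2`, `η > 0` and a smooth `Λ : ℝ⁴ → ℝ⁴`, injective and immersive on `B̄_R`, equal to
  the chart shadow `proj5 ∘ ι ∘ e 0` on the shell `R ≤ |u| ≤ R + η`, over whose open image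
  `Λ(B_R)` NO point of `M` above the plane and outside `e 0 (B_R)` casts its shadow.  On paper
  (Disproof §7c (γ′) made honest; W-Morse-analysis-c2 §4.3): Jordan–Brouwer for the smooth
  `3`-sphere `c_ε = proj5 ι e₀(S_R)` plus sheet counting (file `…StubPleatFreeStandardSheets`)
  show that the region `R_ε` it bounds is free of foreign shadows and that the outer sheet is
  single; the radial isotopy `r ↦ proj5 ι e₀|S_r` (`0 < r ≤ R`, embedded spheres throughout, the
  fold spheres included) with the tree's isotopy extension (`EuclideanIsotopyExtension`) and collar
  uniqueness (`CollarUniquenessBall`) make `R_ε` a standard ball REL the collar `proj5 ι e₀` —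
  which is exactly `Λ`.  Not proved here;
* `cleanOnePleatIroning_of_ironingChart` — **`CleanPleatIroningChart` implies the registered
  stub `stub_cleanOnePleatIroning` verbatim** (separation: a foreign point on the new graph would
  cast its shadow into `Λ(B_R)`, or sit on the seam sphere where `F = ι ∘ e 0` and `ι` is
  injective).

Sources: Disproof.lean §7c (γ)/(γ′); W-Morse-analysis-c2.md §4.3; Hirsch (1976) Ch. 8 §1.
-/

noncomputable section

-- the prescribed namespace `Summit.<P>.<Sub>.…` duplicates `SmoothPoincare4` (P = Sub)
set_option linter.dupNamespace false

open scoped Manifold ContDiff Topology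
open Set Function Filter Metric ContinuousMap

namespace Summit.SmoothPoincare4.SmoothPoincare4.Theorems.OrigamiFoldExistence.ShadowPleats

/-! ### The deletion lemma in kernel form -/

section Deletion

variable {M : Type} [TopologicalSpace M] [ChartedSpace (EuclideanSpace ℝ (Fin 4)) M]
  [IsManifold (𝓡 4) ∞ M]

/-- The fold spheres lie in every closed ball of radius `R ≥ 2`. -/
theorem pleatSpheres_subset_closedBall {R : ℝ} (hR : 2 ≤ R) :
    pleatSpheres ⊆ closedBall (0 : EuclideanSpace ℝ (Fin 4)) R := by
  rintro u (hu | hu)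
  · rw [mem_sphere_zero_iff_norm] at hu
    rw [mem_closedBall_zero_iff, hu]
    linarith
  · rw [mem_sphere_zero_iff_norm] at hu
    rw [mem_closedBall_zero_iff, hu]
    exact hR

/-- **Deletion lemma (Disproof.lean §7c (γ)) in kernel form.**  Let `(ι, δ, e)` be a `1`-pleat
round-rim position of a compact `M`, `R ≥ 2` (so both fold spheres of the chart `e 0` lie in
`B̄_R`), and let `F : ℝ⁴ → ℝ⁵` be smooth with
* `F = ι ∘ e 0` on the shell `R ≤ |u| ≤ R + η` (`η > 0`) — smooth seam;
* `F` injective on `B̄_R` with GRAPHICAL image: `proj5 ∘ F` immersive on `B̄_R` — no fold;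
* `F(B̄_R)` strictly above the plane `h = 1 - δ` — round part untouched;
* SEPARATION: `ι m ∉ F(B̄_R)` for every `m ∉ e 0 (B̄_R)` — the new ball misses the rest.
Then cutting `ι` on `e 0 (B̄_R)` and pasting `F` gives a `0`-pleat position of the same `M`:
`HasPleatedPosition M 0`. [folklore] -/
theorem hasPleatedPosition_zero_of_patch [T2Space M] [CompactSpace M]
    {ι : M → EuclideanSpace ℝ (Fin 5)} {δ : ℝ} {e : Fin 1 → EuclideanSpace ℝ (Fin 4) → M}
    (h : IsPleatedPosition ι δ e) {R η : ℝ} (hR : 2 ≤ R) (hη : 0 < η)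
    {F : EuclideanSpace ℝ (Fin 4) → EuclideanSpace ℝ (Fin 5)} (hF : ContDiff ℝ ∞ F)
    (hagree : ∀ u, R ≤ ‖u‖ → ‖u‖ ≤ R + η → F u = ι (e 0 u))
    (hFinj : InjOn F (closedBall 0 R))
    (hd : ∀ u, ‖u‖ ≤ R → Injective (fderiv ℝ (proj5 ∘ F) u))
    (hhigh : ∀ u, ‖u‖ ≤ R → 1 - δ < F u 4)
    (hsep : ∀ m, m ∉ e 0 '' closedBall 0 R → ι m ∉ F '' closedBall 0 R) :
    HasPleatedPosition M 0 := by
  obtain ⟨hι, hδ0, hδ1, hround, hcharts, -, hinj, -⟩ := h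
  have he : Manifold.IsSmoothEmbedding (𝓡 4) (𝓡 4) ∞ (e 0) := (hcharts 0).1
  have hold : ∀ u, 1 - δ < ι (e 0 u) 4 := (hcharts 0).2
  have hpF : ContDiff ℝ ∞ (proj5 ∘ F) := by
    rw [← coe_proj5L]
    exact proj5L.contDiff.comp hF
  -- `dF` is injective where `d(proj5 ∘ F) = proj5L ∘ dF` is
  have hdF : ∀ u, ‖u‖ ≤ R → Injective (fderiv ℝ F u) := by
    intro u hu
    have hcomp : fderiv ℝ (proj5 ∘ F) u =
        (proj5L : EuclideanSpace ℝ (Fin 5) →L[ℝ] EuclideanSpace ℝ (Fin 4)).comp (fderiv ℝ F u) := by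
      rw [← coe_proj5L, fderiv_comp u proj5L.differentiableAt (hF.differentiable (by simp) u),
        ContinuousLinearMap.fderiv]
    have := hd u hu
    rw [hcomp, ContinuousLinearMap.coe_comp] at this
    exact Injective.of_comp this
  refine ⟨patch ι (e 0) R F, δ, Fin.elim0, ?_, hδ0, hδ1, ?_, ?_, ?_, ?_, ?_⟩
  · exact isSmoothEmbedding_patch hι he hF hη hagree hFinj hdF hsep
  · exact round_patch he.isEmbedding.injective hround hold hhigh
  · exact fun j => j.elim0
  · exact fun j => j.elim0
  · -- the new shadow is immersive everywhere above the plane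
    intro m hm _
    by_cases hmem : m ∈ e 0 '' closedBall 0 R
    · obtain ⟨u, hu, rfl⟩ := hmem
      have hle : ‖u‖ ≤ R := mem_closedBall_zero_iff.1 hu
      exact injective_mfderiv_shadow_patch_chart he hF hagree (by linarith) (hd u hle)
    · rw [mfderiv_shadow_patch_of_notMem he hmem]
      rw [patch_of_notMem hmem] at hm
      refine hinj m hm ?_
      simp only [Set.mem_iUnion, not_exists]
      intro j hj
      obtain rfl : j = 0 := Subsingleton.elim j 0
      exact hmem (Set.image_mono (pleatSpheres_subset_closedBall hR) hj)
  · exact fun j => j.elim0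

end Deletion

/-! ### The graphical re-embedding over an ironing chart -/

section Iron

variable {M : Type} {ι : M → EuclideanSpace ℝ (Fin 5)} {e₀ : EuclideanSpace ℝ (Fin 4) → M}
  {Λ : EuclideanSpace ℝ (Fin 4) → EuclideanSpace ℝ (Fin 4)}

/-- The GRAPHICAL RE-EMBEDDING of a chart ball over an ironing chart `Λ`: new shadow `Λ u`, old
height `h(ι (e₀ u))`. -/
def ironF (Λ : EuclideanSpace ℝ (Fin 4) → EuclideanSpace ℝ (Fin 4)) (ι : M → EuclideanSpace ℝ (Fin 5))
    (e₀ : EuclideanSpace ℝ (Fin 4) → M) (u : EuclideanSpace ℝ (Fin 4)) : EuclideanSpace ℝ (Fin 5) :=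
  embedL (Λ u) + (ι (e₀ u) 4) • e4

/-- The shadow of the graphical re-embedding is the ironing chart. -/
@[simp] theorem proj5_ironF (u : EuclideanSpace ℝ (Fin 4)) : proj5 (ironF Λ ι e₀ u) = Λ u := by
  rw [ironF, proj5_add, proj5_smul, proj5_embedL, proj5_e4, smul_zero, add_zero]

/-- The shadow map of the graphical re-embedding is the ironing chart. -/
theorem proj5_comp_ironF : proj5 ∘ ironF Λ ι e₀ = Λ := funext proj5_ironF

/-- The height of the graphical re-embedding is the old height. -/
@[simp] theorem ironF_apply_four (u : EuclideanSpace ℝ (Fin 4)) : ironF Λ ι e₀ u 4 = ι (e₀ u) 4 := by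
  simp [ironF, embedL_apply, e4]

/-- Where the ironing chart is the old chart shadow, the re-embedding is the old embedding. -/
theorem ironF_eq_of_eq {u : EuclideanSpace ℝ (Fin 4)} (hu : Λ u = proj5 (ι (e₀ u))) :
    ironF Λ ι e₀ u = ι (e₀ u) := by
  rw [ironF, hu, embedL_proj5_add_smul]

/-- The graphical re-embedding is injective where the ironing chart is. -/
theorem injOn_ironF {s : Set (EuclideanSpace ℝ (Fin 4))} (h : InjOn Λ s) : InjOn (ironF Λ ι e₀) s := by
  intro u hu v hv huv
  have := congrArg proj5 huv
  rw [proj5_ironF, proj5_ironF] at this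
  exact h hu hv this

/-- The graphical re-embedding is smooth (smooth chart, smooth `ι ∘ e₀`). -/
theorem contDiff_ironF [TopologicalSpace M] [ChartedSpace (EuclideanSpace ℝ (Fin 4)) M]
    (hΛ : ContDiff ℝ ∞ Λ) (hιe : ContMDiff (𝓡 4) (𝓡 5) ∞ (ι ∘ e₀)) : ContDiff ℝ ∞ (ironF Λ ι e₀) := by
  have h1 : ContDiff ℝ ∞ (ι ∘ e₀) := contMDiff_iff_contDiff.1 hιe
  have h2 : ContDiff ℝ ∞ fun u => (ι ∘ e₀) u 4 := by
    have : ContDiff ℝ ∞ fun u => heightL ((ι ∘ e₀) u) := heightL.contDiff.comp h1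
    simpa using this
  exact (embedL.contDiff.comp hΛ).add (h2.smul contDiff_const)

end Iron

/-! ### The named missing ingredient and the reduction of the stub to it -/

/-- **IRONING CHARTS EXIST for clean single pleats** — the one ingredient of
`stub_cleanOnePleatIroning` not proved in the tree, stated over the line vocabulary.  For every
homotopy `4`-sphere `M` and every `1`-pleat round-rim position `(ι, δ, e)` of `M` whose chart
`e 0` is clean, there are `R ≥ 2`, `η > 0` and a smooth `Λ : ℝ⁴ → ℝ⁴` with
* `Λ` injective on the closed ball `B̄_R` with injective differential there (a flat chart of
  its image, the closed region `R_ε ⊂ ℝ⁴` bounded by the sphere `proj5 ι e 0 (S_R)`);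
* `Λ = proj5 ∘ ι ∘ e 0` on the shell `R ≤ |u| ≤ R + η` (it continues the chart shadow across
  the seam sphere);
* NO FOREIGN SHADOW over the open region: a point of `M` strictly above the plane and not in
  `e 0 (B_R)` does not cast its shadow into `Λ(B_R)`.
Paper proof (all clean `1`-pleat positions, both height types Z and S = "mushroom", the latter
possibly overhanging the round part — W-Morse-analysis-c2 §4.3).  TOPOLOGICAL HALF (last
clause): `c_ε := proj5 ι e 0 (S_R)` is a smoothly embedded `3`-sphere with an explicit bicollar
(the chart shadow is injective near `S_R` and a local diffeomorphism there); by Jordan–Brouwer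
(tree: `JordanBrouwerClosedHypersurface`, `SphereHypersurfaceSides`) it bounds a compact region
`R_ε`; the collar `e 0 {2 ≤ |u| ≤ R}` casts its shadow INTO `R_ε` and the outer sheet
`N = {h > 1 - δ} ∖ e 0 (B̄_R)` leaves `c_ε` OUTWARD (the opposite arrangement would glue two
copies of `ℝ⁴ ∖ R_ε°` to `N̄` into a connected two-sheeted covering of `ℝ⁴` — excluded by simple
connectivity, Mathlib `IsCoveringMap` lifting as in the tree's `SchoenfliesSeparation`); then the
count `[y ∈ R_ε] + #(sheets of N over y)` is locally constant on `ℝ⁴ ∖ S_ρ` (properness from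
compactness, exactly as in `existsUnique_preimage` of `…StubPleatFreeStandardSheets`), `0` far
away and `1` just inside the rim, hence NO sheet of `N` over `R_ε°` (and exactly one over
`B_ρ ∖ R_ε`: the outer sheet is single — Disproof §7c (γ′) "only a fold can thread a pocket",
made honest).  SMOOTH HALF (`Λ`): NOT the smooth Schoenflies problem, because the sphere comes
with the radial isotopy `r ↦ proj5 ι e 0|S_r`, `0 < r ≤ R`, through EMBEDDED `3`-spheres (on the
three clean pieces by the injectivity clauses, across the two fold spheres because the kernel of
a Whitney fold is transverse to its fold locus, `IsFoldPointAt` ⇒ `d(det dG)(v) ≠ 0`), from a tiny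
sphere bounding the standard ball `proj5 ι e 0 (B̄_r)`, `r < 1`; isotopy extension in `ℝ⁴` (tree:
`EuclideanIsotopyExtension.exists_diffeomorph_comp_eq_of_smoothIsotopy_euclidean`) carries that
ball onto `R_ε` (tree: `RegularLevelTwoSides.image_setOf_le_eq_of_image_setOf_eq_eq` pattern),
and uniqueness of collars (tree: `CollarUniquenessBall`) corrects the parametrisation near `S_R`
to agree with the chart shadow, after which it extends by the chart shadow across the sphere. -/
def CleanPleatIroningChart : Prop :=
  ∀ (M : Type) [TopologicalSpace M] [T2Space M] [SecondCountableTopology M]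
    [ChartedSpace (EuclideanSpace ℝ (Fin 4)) M] [IsManifold (𝓡 4) ∞ M],
    M ≃ₕ (Metric.sphere (0 : EuclideanSpace ℝ (Fin 5)) 1) →
    ∀ (ι : M → EuclideanSpace ℝ (Fin 5)) (δ : ℝ) (e : Fin 1 → EuclideanSpace ℝ (Fin 4) → M),
      IsPleatedPosition ι δ e → IsCleanPleat ι (e 0) →
      ∃ (R η : ℝ) (Λ : EuclideanSpace ℝ (Fin 4) → EuclideanSpace ℝ (Fin 4)),
        2 ≤ R ∧ 0 < η ∧ ContDiff ℝ ∞ Λ ∧ Set.InjOn Λ (Metric.closedBall 0 R) ∧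
        (∀ u ∈ Metric.closedBall (0 : EuclideanSpace ℝ (Fin 4)) R, Function.Injective (fderiv ℝ Λ u)) ∧
        (∀ u, R ≤ ‖u‖ → ‖u‖ ≤ R + η → Λ u = proj5 (ι (e 0 u))) ∧
        (∀ m, 1 - δ < ι m 4 → m ∉ e 0 '' Metric.ball 0 R → proj5 (ι m) ∉ Λ '' Metric.ball 0 R)

/-- **Reduction of the deletion to an ironing chart** (unbundled): a `1`-pleat position of a
compact `M` together with an ironing chart `Λ` of its chart ball (the data of
`CleanPleatIroningChart`) yields a `0`-pleat position, by the deletion lemma applied to the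
graphical re-embedding `ironF Λ ι (e 0)`. [folklore] -/
theorem hasPleatedPosition_zero_of_ironingChart {M : Type} [TopologicalSpace M] [T2Space M]
    [ChartedSpace (EuclideanSpace ℝ (Fin 4)) M] [IsManifold (𝓡 4) ∞ M] [CompactSpace M]
    {ι : M → EuclideanSpace ℝ (Fin 5)} {δ : ℝ} {e : Fin 1 → EuclideanSpace ℝ (Fin 4) → M}
    (h : IsPleatedPosition ι δ e) {R η : ℝ} (hR : 2 ≤ R) (hη : 0 < η)
    {Λ : EuclideanSpace ℝ (Fin 4) → EuclideanSpace ℝ (Fin 4)} (hΛ : ContDiff ℝ ∞ Λ)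
    (hinj : InjOn Λ (closedBall 0 R)) (hd : ∀ u ∈ closedBall (0 : EuclideanSpace ℝ (Fin 4)) R,
      Injective (fderiv ℝ Λ u))
    (hagree : ∀ u, R ≤ ‖u‖ → ‖u‖ ≤ R + η → Λ u = proj5 (ι (e 0 u)))
    (hfree : ∀ m, 1 - δ < ι m 4 → m ∉ e 0 '' ball 0 R → proj5 (ι m) ∉ Λ '' ball 0 R) :
    HasPleatedPosition M 0 := by
  have hι : Manifold.IsSmoothEmbedding (𝓡 4) (𝓡 5) ∞ ι := h.1
  have he : Manifold.IsSmoothEmbedding (𝓡 4) (𝓡 4) ∞ (e 0) := (h.2.2.2.2.1 0).1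
  have hold : ∀ u, 1 - δ < ι (e 0 u) 4 := (h.2.2.2.2.1 0).2
  set F := ironF Λ ι (e 0) with hF
  have hFsmooth : ContDiff ℝ ∞ F := contDiff_ironF hΛ (hι.contMDiff.comp he.contMDiff)
  have hFagree : ∀ u, R ≤ ‖u‖ → ‖u‖ ≤ R + η → F u = ι (e 0 u) := fun u h1 h2 =>
    ironF_eq_of_eq (hagree u h1 h2)
  refine hasPleatedPosition_zero_of_patch h hR hη hFsmooth hFagree (injOn_ironF hinj) ?_ ?_ ?_
  · -- the new shadow `proj5 ∘ F = Λ` is immersive on the closed ball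
    intro u hu
    rw [hF, proj5_comp_ironF]
    exact hd u (mem_closedBall_zero_iff.2 hu)
  · -- the new ball stays above the plane (old heights)
    intro u _
    rw [hF, ironF_apply_four]
    exact hold u
  · -- SEPARATION from the foreign-shadow clause of the ironing chart
    intro m hm hmem
    obtain ⟨u, hu, hFu⟩ := hmem
    have hle : ‖u‖ ≤ R := mem_closedBall_zero_iff.1 hu
    have hheight : 1 - δ < ι m 4 := by
      rw [← hFu, hF, ironF_apply_four]
      exact hold u
    have hshadow : proj5 (ι m) = Λ u := by rw [← hFu, hF, proj5_ironF]
    have hm' : m ∉ e 0 '' ball 0 R := fun ⟨v, hv, hvm⟩ => hm ⟨v, ball_subset_closedBall hv, hvm⟩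
    have hnot := hfree m hheight hm'
    rw [hshadow] at hnot
    -- so `u` is not in the open ball: it lies on the seam sphere `|u| = R`
    have hR' : R ≤ ‖u‖ := by
      by_contra hlt
      exact hnot ⟨u, mem_ball_zero_iff.2 (not_le.1 hlt), rfl⟩
    have hFu' : F u = ι (e 0 u) := hFagree u hR' (by linarith)
    rw [hFu'] at hFu
    exact hm ⟨u, hu, hι.isEmbedding.injective hFu⟩

/-- **The registered stub `stub_cleanOnePleatIroning`, reduced to the existence of ironing
charts**: `CleanPleatIroningChart` implies, VERBATIM, that a homotopy `4`-sphere with a clean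
`1`-pleat round-rim shadow position has a pleat-free one (compactness of `M` from the tree's
`compactSpace_of_homotopyEquiv_sphere_four_holds`; `hasCleanPleatedPosition_one_iff`; deletion
over the graphical re-embedding). [folklore] -/
theorem cleanOnePleatIroning_of_ironingChart (hC : CleanPleatIroningChart) :
    ∀ (M : Type) [TopologicalSpace M] [T2Space M] [SecondCountableTopology M]
      [ChartedSpace (EuclideanSpace ℝ (Fin 4)) M] [IsManifold (𝓡 4) ∞ M],
      M ≃ₕ (Metric.sphere (0 : EuclideanSpace ℝ (Fin 5)) 1) →
      HasCleanPleatedPosition M 1 → HasPleatedPosition M 0 := by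
  intro M _ _ _ _ _ hM hclean
  haveI : CompactSpace M :=
    Literature.Topology.FourManifolds.compactSpace_of_homotopyEquiv_sphere_four_holds M hM
  obtain ⟨ι, δ, e, hpos, hc⟩ := (hasCleanPleatedPosition_one_iff M).1 hclean
  obtain ⟨R, η, Λ, hR, hη, hΛ, hinj, hd, hagree, hfree⟩ := hC M hM ι δ e hpos hc
  exact hasPleatedPosition_zero_of_ironingChart hpos hR hη hΛ hinj hd hagree hfree

end Summit.SmoothPoincare4.SmoothPoincare4.Theorems.OrigamiFoldExistence.ShadowPleats

end
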